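import Mathlib
import Summits.ValiantsHypothesis.ValiantsHypothesis.Theorems.GeneratorObstructionsPowGenDegreeQPDoublingGadget

/-!
# Route GeneratorObstructions — crux K1 `PerGenDegreeSuperQP` (stmt-ValiantsHypothesis-11654), line
# `per-side-atoms`: the lateness package of the PADDED doubling gadget

Helper file (`--supports stmt-ValiantsHypothesis-11654`).  Companion of
`…PerGenDegreeSuperQPPaddedGadget` (the padded doubling gadget
`p = x_z^e · Σ_{j<c} x_{B j}^k x_{A j}^{2k} x_{A' j}^{2k}` is a degeneration of `per_{5kc+1}`) and of
`…PowGenDegreeQPDoublingGadget` (the unpadded lateness package).  The padding letter `z` is shared by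
all summands, so the diagonal stabiliser of `p` is
`{d : d_z^e · d_{B j}^k d_{A j}^{2k} d_{A' j}^{2k} = 1 ∀ j}` (times free scalings off the support):

* `exists_stabilizer_relations_padded` — a set `S` of diagonal (upper triangular) elements fixing `p`
  whose annihilated weights satisfy `χ(A j) = χ(A' j) = 2 χ(B j)`, `χ = 0` off the support, and
  `2k · χ(z) = e · Σ_j χ(A j)`;
* `padded_gadget_lateness_package` — with the interleaved order `A j < B (j+1) < A' j` every NONZERO
  nonpositive antitone weight annihilated by `S` has `-|χ| ≥ 2^c` (doubling along the chain; the pure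
  padding weight is excluded by the last relation, `k ≥ 1`).

So the evaluation-lateness engine `perGenDegreeSuperQP_of_evalLate` applies to the padded gadget as
soon as ONE highest-weight vector of nonconstant weight does not vanish at it (the remaining input).

Honest framing: stabiliser bookkeeping; no stub, crux or summit is settled here; `VP ≠ VNP`
untouched. [folklore]
-/

namespace Summit.ValiantsHypothesis.ValiantsHypothesis.Theorems.GeneratorObstructions.PerGenDegreeSuperQP

open MvPolynomial
open Literature.NumberTheory.DiophantineGeometry Literature.Computability.AlgebraicComplexity
open Summit.ValiantsHypothesis.ValiantsHypothesis.Theorems.GeneratorObstructions.PowGenDegreeQP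

-- `Summit.ValiantsHypothesis.ValiantsHypothesis.…` is the tree's mandated single-conjunct layout.
set_option linter.dupNamespace false

noncomputable section

section Padded

variable {σ : Type*} [Fintype σ] [LinearOrder σ] {c k e : ℕ}

/-- A diagonal scaling acts on the padded gadget monomial by the scalar
`d(z)^e · d(B)^k d(A)^{2k} d(A')^{2k}`. [folklore] -/
theorem linSubst_diagonal_paddedMonomial (d : σ → ℂ) (z b a a' : σ) (k e : ℕ) :
    linSubst σ ℂ (Matrix.diagonal d) (X z ^ e * (X b ^ k * (X a ^ (2 * k) * X a' ^ (2 * k)))) =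
      C (d z ^ e * (d b ^ k * (d a ^ (2 * k) * d a' ^ (2 * k)))) *
        (X z ^ e * (X b ^ k * (X a ^ (2 * k) * X a' ^ (2 * k)))) := by
  rw [map_mul, linSubst_diagonal_gadgetMonomial, linSubst_diagonal_X_pow]
  simp only [map_mul]
  ring

/-- **Weights annihilated by the padded gadget's stabiliser.**  For
`p = x_z^e Σ_j x_{B j}^k x_{A j}^{2k} x_{A' j}^{2k}` (`B, A, A'` injective with pairwise disjoint images,
`z` off them) there is a set `S` of upper triangular elements fixing `p` such that every weight with
character `1` on `S` satisfies `χ(A j) = 2χ(B j)`, `χ(A' j) = 2χ(B j)`, `χ(u) = 0` for `u` off the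
support (`u ≠ z`), and `2k χ(z) = e Σ_j χ(A j)`. [folklore] -/
theorem exists_stabilizer_relations_padded (B A A' : Fin c → σ) (z : σ)
    (hBi : Function.Injective B) (hAi : Function.Injective A) (hA'i : Function.Injective A')
    (hBA : ∀ i j, B i ≠ A j) (hBA' : ∀ i j, B i ≠ A' j) (hAA' : ∀ i j, A i ≠ A' j)
    (hzB : ∀ j, z ≠ B j) (hzA : ∀ j, z ≠ A j) (hzA' : ∀ j, z ≠ A' j)
    (p : MvPolynomial σ ℂ)
    (hp : p = X z ^ e * ∑ j : Fin c, X (B j) ^ k * (X (A j) ^ (2 * k) * X (A' j) ^ (2 * k))) :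
    ∃ S : Set (GL σ ℂ), (∀ t ∈ S, IsUpperTriangular t ∧ linSubstRep σ ℂ t p = p) ∧
      ∀ χ : Weight σ, (∀ t ∈ S, weightChar χ t = 1) →
        (∀ j, χ (A j) = 2 * χ (B j)) ∧ (∀ j, χ (A' j) = 2 * χ (B j)) ∧
        (∀ x, (∀ j, x ≠ B j) → (∀ j, x ≠ A j) → (∀ j, x ≠ A' j) → x ≠ z → χ x = 0) ∧
        2 * (k : ℤ) * χ z = (e : ℤ) * ∑ j, χ (A j) := by
  classical
  -- rewrite `p` as a sum of padded monomials
  have hp' : p = ∑ j : Fin c, X z ^ e * (X (B j) ^ k * (X (A j) ^ (2 * k) * X (A' j) ^ (2 * k))) := by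
    rw [hp, Finset.mul_sum]
  -- the exponent pattern of the coupling element: `z ↦ 2^{-2k}`, `A j ↦ 2^e`
  set w : σ → ℤ := fun x => (if x = z then -(2 * (k : ℤ)) else 0) +
    ∑ j : Fin c, (if x = A j then (e : ℤ) else 0) with hw
  have two_ne : (2 : ℂ) ≠ 0 := two_ne_zero
  have hwz : w z = -(2 * (k : ℤ)) := by
    simp only [hw, if_true]
    rw [Finset.sum_eq_zero (fun j _ => if_neg (hzA j)), add_zero]
  have hwB : ∀ i, w (B i) = 0 := by
    intro i
    simp only [hw, if_neg (hzB i).symm, zero_add]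
    exact Finset.sum_eq_zero (fun j _ => if_neg (hBA i j))
  have hwA : ∀ i, w (A i) = e := by
    intro i
    simp only [hw, if_neg (hzA i).symm, zero_add]
    rw [Finset.sum_eq_single i (fun j _ hj => if_neg (fun h => hj (hAi h).symm))
      (fun h => absurd (Finset.mem_univ i) h), if_pos rfl]
  have hwA' : ∀ i, w (A' i) = 0 := by
    intro i
    simp only [hw, if_neg (hzA' i).symm, zero_add]
    exact Finset.sum_eq_zero (fun j _ => if_neg (fun h => hAA' j i h.symm))
  -- `2^(Σ) = ∏ 2^(·)`
  have two_zpow_sum : ∀ (s : Finset σ) (f : σ → ℤ),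
      (2 : ℂ) ^ (∑ i ∈ s, f i) = ∏ i ∈ s, (2 : ℂ) ^ f i := by
    intro s f
    induction s using Finset.induction_on with
    | empty => simp
    | insert a s ha ih => rw [Finset.sum_insert ha, Finset.prod_insert ha, zpow_add₀ two_ne, ih]
  -- the four families of diagonal scalings
  set d₁ : Fin c → σ → ℂ := fun j x => if x = B j then 4 else if x = A j then 2⁻¹ else 1 with hd₁
  set d₂ : Fin c → σ → ℂ := fun j x => if x = A j then 2 else if x = A' j then 2⁻¹ else 1 with hd₂
  set d₃ : σ → σ → ℂ := fun u x => if x = u then 2 else 1 with hd₃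
  set d₄ : σ → ℂ := fun x => (2 : ℂ) ^ (w x) with hd₄
  have hd₁0 : ∀ j x, d₁ j x ≠ 0 := by intro j x; simp only [hd₁]; split_ifs <;> norm_num
  have hd₂0 : ∀ j x, d₂ j x ≠ 0 := by intro j x; simp only [hd₂]; split_ifs <;> norm_num
  have hd₃0 : ∀ u x, d₃ u x ≠ 0 := by intro u x; simp only [hd₃]; split_ifs <;> norm_num
  have hd₄0 : ∀ x, d₄ x ≠ 0 := fun x => zpow_ne_zero _ two_ne
  set t₁ : Fin c → GL σ ℂ := fun j =>
    Matrix.GeneralLinearGroup.mkOfDetNeZero _ (det_diagonal_ne_zero (hd₁0 j)) with ht₁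
  set t₂ : Fin c → GL σ ℂ := fun j =>
    Matrix.GeneralLinearGroup.mkOfDetNeZero _ (det_diagonal_ne_zero (hd₂0 j)) with ht₂
  set t₃ : σ → GL σ ℂ := fun u =>
    Matrix.GeneralLinearGroup.mkOfDetNeZero _ (det_diagonal_ne_zero (hd₃0 u)) with ht₃
  set t₄ : GL σ ℂ := Matrix.GeneralLinearGroup.mkOfDetNeZero _ (det_diagonal_ne_zero hd₄0) with ht₄
  set off : Set σ := {u | (∀ j, u ≠ B j) ∧ (∀ j, u ≠ A j) ∧ (∀ j, u ≠ A' j) ∧ u ≠ z} with hoff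
  refine ⟨Set.range t₁ ∪ Set.range t₂ ∪ t₃ '' off ∪ {t₄}, ?_, ?_⟩
  · -- every element is upper triangular and fixes `p`
    have hfix : ∀ (d : σ → ℂ) (hd : ∀ x, d x ≠ 0),
        (∀ j, d z ^ e * (d (B j) ^ k * (d (A j) ^ (2 * k) * d (A' j) ^ (2 * k))) = 1) →
        linSubstRep σ ℂ (Matrix.GeneralLinearGroup.mkOfDetNeZero _ (det_diagonal_ne_zero hd)) p = p := by
      intro d hd hmon
      rw [linSubstRep_apply, Matrix.GeneralLinearGroup.val_mkOfDetNeZero, hp', map_sum]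
      refine Finset.sum_congr rfl fun j _ => ?_
      rw [linSubst_diagonal_paddedMonomial, hmon j, map_one, one_mul]
    rintro t (((⟨j, rfl⟩ | ⟨j, rfl⟩) | ⟨u, hu, rfl⟩) | ht)
    · refine ⟨isUpperTriangular_diagonal (hd₁0 j), hfix _ (hd₁0 j) fun i => ?_⟩
      have hz : d₁ j z = 1 := by simp [hd₁, hzB j, hzA j]
      rw [hz, one_pow, one_mul]
      by_cases hij : i = j
      · subst hij
        have h1 : d₁ i (B i) = 4 := by simp [hd₁]
        have h2 : d₁ i (A i) = 2⁻¹ := by simp [hd₁, (hBA i i).symm]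
        have h3 : d₁ i (A' i) = 1 := by simp [hd₁, (hBA' i i).symm, (hAA' i i).symm]
        rw [h1, h2, h3, one_pow, mul_one, show (4 : ℂ) = 2 ^ 2 by norm_num, ← pow_mul, inv_pow]
        exact mul_inv_cancel₀ (pow_ne_zero _ two_ne)
      · have h1 : d₁ j (B i) = 1 := by simp [hd₁, hBi.ne hij, hBA i j]
        have h2 : d₁ j (A i) = 1 := by simp [hd₁, (hBA j i).symm, hAi.ne hij]
        have h3 : d₁ j (A' i) = 1 := by simp [hd₁, (hBA' j i).symm, (hAA' j i).symm]
        rw [h1, h2, h3]; simp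
    · refine ⟨isUpperTriangular_diagonal (hd₂0 j), hfix _ (hd₂0 j) fun i => ?_⟩
      have hz : d₂ j z = 1 := by simp [hd₂, hzA j, hzA' j]
      rw [hz, one_pow, one_mul]
      by_cases hij : i = j
      · subst hij
        have h1 : d₂ i (B i) = 1 := by simp [hd₂, hBA i i, hBA' i i]
        have h2 : d₂ i (A i) = 2 := by simp [hd₂]
        have h3 : d₂ i (A' i) = 2⁻¹ := by simp [hd₂, (hAA' i i).symm]
        rw [h1, h2, h3, one_pow, one_mul, inv_pow]
        exact mul_inv_cancel₀ (pow_ne_zero _ two_ne)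
      · have h1 : d₂ j (B i) = 1 := by simp [hd₂, hBA i j, hBA' i j]
        have h2 : d₂ j (A i) = 1 := by simp [hd₂, hAi.ne hij, hAA' i j]
        have h3 : d₂ j (A' i) = 1 := by simp [hd₂, (hAA' j i).symm, hA'i.ne hij]
        rw [h1, h2, h3]; simp
    · obtain ⟨huB, huA, huA', huz⟩ := hu
      refine ⟨isUpperTriangular_diagonal (hd₃0 u), hfix _ (hd₃0 u) fun i => ?_⟩
      have hz : d₃ u z = 1 := by simp [hd₃, huz.symm]
      have h1 : d₃ u (B i) = 1 := by simp [hd₃, (huB i).symm]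
      have h2 : d₃ u (A i) = 1 := by simp [hd₃, (huA i).symm]
      have h3 : d₃ u (A' i) = 1 := by simp [hd₃, (huA' i).symm]
      rw [hz, h1, h2, h3]; simp
    · rw [Set.mem_singleton_iff] at ht
      subst ht
      refine ⟨isUpperTriangular_diagonal hd₄0, hfix _ hd₄0 fun i => ?_⟩
      simp only [hd₄]
      rw [hwz, hwB, hwA, hwA']
      simp only [zpow_zero, one_pow, one_mul, mul_one]
      rw [← zpow_natCast, ← zpow_natCast, ← zpow_mul, ← zpow_mul, ← zpow_add₀ two_ne]
      have : -(2 * (k : ℤ)) * ((e : ℕ) : ℤ) + (e : ℤ) * ((2 * k : ℕ) : ℤ) = 0 := by push_cast; ring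
      rw [this, zpow_zero]
  · -- the relations
    intro χ hχ
    have hzpow : ∀ n : ℤ, (2 : ℂ) ^ n = 1 → n = 0 := by
      intro n h
      have hn : ‖(2 : ℂ) ^ n‖ = 1 := by rw [h, norm_one]
      rw [norm_zpow, Complex.norm_two] at hn
      have hinj := zpow_right_injective₀ (by norm_num : (0 : ℝ) < 2) (by norm_num : (2 : ℝ) ≠ 1)
      exact hinj (by simpa using hn)
    have hw₁ : ∀ j, weightChar χ (t₁ j) = (2 : ℂ) ^ (2 * χ (B j) - χ (A j)) := by
      intro j
      rw [ht₁]
      simp only []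
      rw [weightChar_diagonal (hd₁0 j)]
      rw [Finset.prod_eq_mul (B j) (A j) (hBA j j) (fun x _ hx => by
        obtain ⟨hxB, hxA⟩ := hx
        simp only [hd₁, if_neg hxB, if_neg hxA, one_zpow])
        (fun h => absurd (Finset.mem_univ _) h) (fun h => absurd (Finset.mem_univ _) h)]
      have h1 : d₁ j (B j) = 4 := by simp [hd₁]
      have h2 : d₁ j (A j) = 2⁻¹ := by simp [hd₁, (hBA j j).symm]
      rw [h1, h2, show (4 : ℂ) = 2 ^ (2 : ℤ) by norm_num, ← zpow_mul, inv_zpow', ← zpow_add₀ two_ne,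
        ← sub_eq_add_neg]
    have hw₂ : ∀ j, weightChar χ (t₂ j) = (2 : ℂ) ^ (χ (A j) - χ (A' j)) := by
      intro j
      rw [ht₂]
      simp only []
      rw [weightChar_diagonal (hd₂0 j)]
      rw [Finset.prod_eq_mul (A j) (A' j) (hAA' j j) (fun x _ hx => by
        obtain ⟨hxA, hxA'⟩ := hx
        simp only [hd₂, if_neg hxA, if_neg hxA', one_zpow])
        (fun h => absurd (Finset.mem_univ _) h) (fun h => absurd (Finset.mem_univ _) h)]
      have h1 : d₂ j (A j) = 2 := by simp [hd₂]
      have h2 : d₂ j (A' j) = 2⁻¹ := by simp [hd₂, (hAA' j j).symm]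
      rw [h1, h2, inv_zpow', ← zpow_add₀ two_ne, ← sub_eq_add_neg]
    have hw₃ : ∀ u, weightChar χ (t₃ u) = (2 : ℂ) ^ (χ u) := by
      intro u
      rw [ht₃]
      simp only []
      rw [weightChar_diagonal (hd₃0 u), Finset.prod_eq_single u (fun x _ hx => by
        simp only [hd₃, if_neg hx, one_zpow]) (fun h => absurd (Finset.mem_univ _) h)]
      simp [hd₃]
    have hw₄ : weightChar χ t₄ = (2 : ℂ) ^ (-(2 * (k : ℤ)) * χ z + (e : ℤ) * ∑ j, χ (A j)) := by
      rw [ht₄, weightChar_diagonal hd₄0]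
      have hprod : (∏ x, d₄ x ^ χ x) = (2 : ℂ) ^ (∑ x, w x * χ x) := by
        rw [two_zpow_sum]
        refine Finset.prod_congr rfl fun x _ => ?_
        simp only [hd₄]
        rw [← zpow_mul]
      rw [hprod]
      congr 1
      -- `Σ_x w x · χ x = -2k χ z + e Σ_j χ (A j)`
      have hsum : (∑ x, w x * χ x) = ∑ x, ((if x = z then -(2 * (k : ℤ)) * χ x else 0) +
          ∑ j : Fin c, (if x = A j then (e : ℤ) * χ x else 0)) := by
        refine Finset.sum_congr rfl fun x _ => ?_
        simp only [hw, add_mul, Finset.sum_mul]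
        congr 1
        · split_ifs <;> simp
        · exact Finset.sum_congr rfl fun j _ => by split_ifs <;> simp
      rw [hsum, Finset.sum_add_distrib, Finset.sum_ite_eq' Finset.univ z, if_pos (Finset.mem_univ z),
        Finset.sum_comm]
      congr 1
      rw [Finset.mul_sum]
      refine Finset.sum_congr rfl fun j _ => ?_
      rw [Finset.sum_ite_eq' Finset.univ (A j), if_pos (Finset.mem_univ _)]
    have hrelA : ∀ j, χ (A j) = 2 * χ (B j) := by
      intro j
      have h := hχ (t₁ j) (Or.inl (Or.inl (Or.inl ⟨j, rfl⟩)))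
      rw [hw₁] at h
      have := hzpow _ h
      omega
    have hrelA' : ∀ j, χ (A' j) = 2 * χ (B j) := by
      intro j
      have h := hχ (t₂ j) (Or.inl (Or.inl (Or.inr ⟨j, rfl⟩)))
      rw [hw₂] at h
      have := hzpow _ h
      rw [← hrelA j]
      omega
    refine ⟨hrelA, hrelA', fun x hxB hxA hxA' hxz => ?_, ?_⟩
    · have h := hχ (t₃ x) (Or.inl (Or.inr ⟨x, ⟨hxB, hxA, hxA', hxz⟩, rfl⟩))
      rw [hw₃] at h
      exact hzpow _ h
    · have h := hχ t₄ (Or.inr rfl)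
      rw [hw₄] at h
      have := hzpow _ h
      linarith

/-- **The padded gadget's lateness package** (hypotheses `hS`, `harith` of
`exists_late_genType_of_stabilizer` / `perGenDegreeSuperQP_of_evalLate`, with `D = 2^c`): for the padded
doubling gadget on interleaved letters (`k ≥ 1`) there is a set of upper triangular elements fixing it
such that every NONZERO nonpositive antitone weight annihilated by it has `-|χ| ≥ 2^c`. [folklore] -/
theorem padded_gadget_lateness_package (B A A' : Fin c → σ) (z : σ) (hc : 0 < c) (hk : 1 ≤ k)
    (hBi : Function.Injective B) (hAi : Function.Injective A) (hA'i : Function.Injective A')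
    (hBA : ∀ i j, B i ≠ A j) (hBA' : ∀ i j, B i ≠ A' j) (hAA' : ∀ i j, A i ≠ A' j)
    (hzB : ∀ j, z ≠ B j) (hzA : ∀ j, z ≠ A j) (hzA' : ∀ j, z ≠ A' j)
    (hord1 : ∀ (j : Fin c) (h : j.val + 1 < c), A j < B ⟨j.val + 1, h⟩)
    (hord2 : ∀ (j : Fin c) (h : j.val + 1 < c), B ⟨j.val + 1, h⟩ < A' j)
    (p : MvPolynomial σ ℂ)
    (hp : p = X z ^ e * ∑ j : Fin c, X (B j) ^ k * (X (A j) ^ (2 * k) * X (A' j) ^ (2 * k))) :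
    ∃ S : Set (GL σ ℂ), (∀ t ∈ S, IsUpperTriangular t ∧ linSubstRep σ ℂ t p = p) ∧
      ∀ χ : Weight σ, χ ≠ 0 → Antitone χ → (∀ i, χ i ≤ 0) →
        (∀ t ∈ S, weightChar χ t = 1) → (2 : ℤ) ^ c ≤ -(Weight.size χ) := by
  obtain ⟨S, hS, hrel⟩ :=
    exists_stabilizer_relations_padded B A A' z hBi hAi hA'i hBA hBA' hAA' hzB hzA hzA' p hp
  refine ⟨S, hS, fun χ hne hanti hnonpos hχ => ?_⟩
  obtain ⟨hA, hA', hoff, hz⟩ := hrel χ hχ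
  by_cases hB0 : χ (B ⟨0, hc⟩) = 0
  · -- all block weights vanish, hence `χ z = 0`, hence `χ = 0`
    exfalso
    apply hne
    have hB : ∀ j : Fin c, χ (B j) = 0 := by
      intro j
      have h := apply_B_eq_pow_mul B A A' χ hanti hA hA' hord1 hord2 hc j.val j.isLt
      rw [hB0, mul_zero] at h
      exact h
    have hzz : χ z = 0 := by
      have hsum : ∑ j, χ (A j) = 0 := Finset.sum_eq_zero fun j _ => by rw [hA, hB, mul_zero]
      rw [hsum, mul_zero] at hz
      have hk' : (2 * (k : ℤ)) ≠ 0 := by omega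
      exact (mul_eq_zero.mp hz).resolve_left hk'
    funext x
    rw [Pi.zero_apply]
    by_cases h1 : ∃ j, x = B j
    · obtain ⟨j, rfl⟩ := h1; exact hB j
    by_cases h2 : ∃ j, x = A j
    · obtain ⟨j, rfl⟩ := h2; rw [hA, hB, mul_zero]
    by_cases h3 : ∃ j, x = A' j
    · obtain ⟨j, rfl⟩ := h3; rw [hA', hB, mul_zero]
    by_cases h4 : x = z
    · rw [h4]; exact hzz
    push Not at h1 h2 h3
    exact hoff x h1 h2 h3 h4
  · exact pow_le_neg_size_of_doubling B A A' χ hanti hnonpos hA hA' hord1 hord2 hc hB0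

end Padded

end

end Summit.ValiantsHypothesis.ValiantsHypothesis.Theorems.GeneratorObstructions.PerGenDegreeSuperQP
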